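import Mathlib
import Summits.Ventures.PercRepro.TriangleCapClosedFormKM
import Summits.Ventures.PercRepro.TriangleCapTableStatement

/-!
# PercRepro — THE `K₄⁻`-FREE CHERRY TABLE IS DETERMINED ON EVERY CELL (p3, gen 40; part 164)

**`cherry_table_every_cell (k m) (hk : 6 ≤ k) (hm : 4m ≤ k²)`**: for every `k ≥ 6` and every `m ≤ ⌊k²/4⌋` the
maximum `M` of `Σ_v C(d(v), 2)` over the `K₄⁻`-free graphs on `Fin k` with `m` edges exists, is attained, and
is the value of the closed form §10av: on `m ≤ 2k − 4` the table of part 114 (`table_km`: `C(m, 2)` on the star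
rows, `max(C(k−1, 2) + 2t, C(k−2, 2) + C(t+1, 2) + t + 1)` for `m = k − 1 + t`), on `2k − 3 ≤ m` the closed
form `2M + r (k − 1 − r) = m (k − 2)` with `r` the distance of `m` to the nearest product `a (k − a)` above it
(part 163). Axioms: standard.
-/

namespace PercRepro

namespace TriangleCap

namespace C047

open Finset

/-- **THE WHOLE TABLE:** every cell `(k, m)` with `k ≥ 6`, `4m ≤ k²` has an attained maximum `M` of the cherry
count over the `K₄⁻`-free graphs, equal to the table value below `2k − 3` and to the closed form from `2k − 3` on. -/
theorem cherry_table_every_cell (k m : ℕ) (hk : 6 ≤ k) (hm : 4 * m ≤ k * k) :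
    ∃ M, (∀ (D : SimpleGraph (Fin k)) [DecidableRel D.Adj], K4mFree D → D.edgeFinset.card = m →
        cherries D ≤ M) ∧
      (∃ (D : SimpleGraph (Fin k)) (_ : DecidableRel D.Adj), K4mFree D ∧ D.edgeFinset.card = m ∧
        cherries D = M) ∧
      ((m + 4 ≤ 2 * k ∧ M = (if m + 1 ≤ k then m.choose 2 else
          max ((k - 1).choose 2 + 2 * (m + 1 - k)) ((k - 2).choose 2 + (m + 2 - k).choose 2 + (m + 2 - k)))) ∨
        (2 * k ≤ m + 3 ∧ ∃ r, (∃ a, 3 ≤ a ∧ 2 * a + r ≤ k ∧ a * (k - a) = m + r) ∧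
          2 * M + r * (k - 1 - r) = m * (k - 2))) := by
  rcases Nat.lt_or_ge (m + 3) (2 * k) with hlow | hdense
  · obtain ⟨h1, h2⟩ := table_km k m (by omega)
    exact ⟨_, h1, h2, Or.inl ⟨by omega, rfl⟩⟩
  · obtain ⟨r, -, hcell, h1, D₀, inst, hK₀, hm₀, hc₀⟩ := closed_form_km k m hk hdense hm
    refine ⟨cherries D₀, ?_, ⟨D₀, inst, hK₀, hm₀, rfl⟩, Or.inr ⟨hdense, r, hcell, hc₀⟩⟩
    intro D _ hK hD
    have := h1 D hK hD
    omega

end C047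

end TriangleCap

end PercRepro
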